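import Literature.AnabelianGeometry.EtaleTheta.MuTwoSettingCLevel
import HarnessLib

/-!
# [EtTh] Def. 1.7 / Def. 2.1: the subcoverings `toZ⁻¹(n·ℤ)` of the `ℤ`-covering `Y → X` are GALOIS OVER `C`
# (their tempered groups are normal in `Π^tp_C`), granted the printed definition of `Z`

Mochizuki, *The étale theta function and its Frobenioid-theoretic manifestations*, Publ. RIMS **45** (2009) [EtTh],
§1 p. 12 ("the universal graph-covering of the dual graph of this special fiber determines … a natural surjection
`Π^tp_X ↠ Z`"), Def. 1.7 p. 27 (`C^log = X^log/±1`), Def. 2.1 p. 36 (the degree-`l` subcovering "`X̲^log → X^log`"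
and its quotient `C̲`) [cite: MochizukiEtTh2009, Def 2.1 p.36]. abc-iut cell, layer L6 (seat abc-iut-w5-d225 gen 5;
input (i) of the `𝔽_l^{⋊±}`-clause of [IUTchII] Rmk. 1.1.1 (iv) for the core tower of `CoreTowerNonVacuityUnderline.lean`,
whose field `X` is `inclX(toZ⁻¹(l·ℤ))`). PROOF-ONLY sequel of abc-iut-L2-d3's `MuTwoSettingCLevel.lean`:

* `MuTwoSetting.mem_comap_toZ_zpowers_iff` — `x ∈ toZ⁻¹(n·ℤ) ↔ x = y^n · k` with `k ∈ Π^tp_Y = Ker(toZ)` (`toZ` onto `ℤ`);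
* `MuTwoSetting.CLevelData.map_inclX_comap_toZ_zpowers_normal` — granted "`Π^tp_Y = Ker(Π^tp_X ↠ Z)` is topologically
  generated by the compact subgroups" (abc-iut-L6-d5's L02 binder `Thm16Sub.KerToZIsCompactlyGenerated`, under which
  `Π^tp_Y ⊴ Π^tp_C`, `CLevelData.map_inclX_GtpY_normal`), `inclX(toZ⁻¹(n·ℤ))` is NORMAL in `Π^tp_C` for every `n : ℤ`
  — in particular for `n = l`: `X̲ → C` is Galois (the orbicurve `C̲ = X̲/±1` of Def. 2.1 makes sense).
HONEST FRAMING: [EtTh] is refereed; the binder is a hypothesis, not discharged; nothing of [IUTchII] asserted; no side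
taken on [IUTchIII] Cor. 3.12.
-/

noncomputable section

namespace Literature.AnabelianGeometry.EtaleTheta

open Literature.AnabelianGeometry.SemiGraphs

variable {p : ℕ} [Fact p.Prime]

namespace MuTwoSetting

variable (M : MuTwoSetting p)

/-- `x ∈ toZ⁻¹(n·ℤ)` iff `x = y^n · k` for some `y ∈ Π^tp_X` and `k ∈ Ker(toZ) = Π^tp_Y` (`toZ` is onto `ℤ`,
[EtTh] §1 p. 12). [cite: MochizukiEtTh2009, §1 p.12] -/
theorem mem_comap_toZ_zpowers_iff (n : ℤ) (x : M.PiTemp) :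
    x ∈ (Subgroup.zpowers (Multiplicative.ofAdd n)).comap M.toZ ↔
      ∃ y : M.PiTemp, ∃ k ∈ M.toZ.ker, x = y ^ n * k := by
  constructor
  · intro hx
    rw [Subgroup.mem_comap, Subgroup.mem_zpowers_iff] at hx
    obtain ⟨m, hm⟩ := hx
    obtain ⟨y, hy⟩ := M.toZ_surjective (Multiplicative.ofAdd m)
    refine ⟨y, (y ^ n)⁻¹ * x, ?_, by rw [mul_inv_cancel_left]⟩
    rw [MonoidHom.mem_ker, map_mul, map_inv, map_zpow, hy, ← hm, ← ofAdd_zsmul, ← ofAdd_zsmul, smul_eq_mul,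
      smul_eq_mul, mul_comm m n, inv_mul_cancel]
  · rintro ⟨y, k, hk, rfl⟩
    rw [Subgroup.mem_comap, map_mul, (MonoidHom.mem_ker).1 hk, mul_one, map_zpow, Subgroup.mem_zpowers_iff]
    obtain ⟨m, hm⟩ : ∃ m : ℤ, M.toZ y = Multiplicative.ofAdd m := ⟨Multiplicative.toAdd (M.toZ y), by simp⟩
    exact ⟨m, by rw [hm, ← ofAdd_zsmul, ← ofAdd_zsmul, smul_eq_mul, smul_eq_mul, mul_comm]⟩

namespace CLevelData

variable {M}

/-- **`inclX(toZ⁻¹(n·ℤ))` is NORMAL in `Π^tp_C`** for every `n : ℤ` — the subcoverings of the `ℤ`-covering `Y → X` are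
Galois over `C` (for `n = l`: "`X̲^log → X^log`" and `C̲ = X̲/±1`, [EtTh] Def. 2.1 p. 36) — granted the printed definition
of `Z` (`Thm16Sub.KerToZIsCompactlyGenerated`, under which `inclX(Π^tp_Y) ⊴ Π^tp_C`): an inner automorphism of
`Π^tp_C` restricts to `Π^tp_X` (`conjX`), is multiplicative, and carries `Ker(toZ)` to itself, hence carries
`y^n · k` to `y'^n · k'`. [cite: MochizukiEtTh2009, Def 2.1 p.36] -/
theorem map_inclX_comap_toZ_zpowers_normal (e : M.CLevelData)
    (h : Thm16Sub.KerToZIsCompactlyGenerated M.toThetaSetting) (n : ℤ) :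
    (((Subgroup.zpowers (Multiplicative.ofAdd n)).comap M.toZ).map M.inclX).Normal := by
  refine ⟨fun z hz g => ?_⟩
  obtain ⟨x, hx, rfl⟩ := hz
  obtain ⟨y, k, hk, rfl⟩ := (M.mem_comap_toZ_zpowers_iff n x).1 hx
  -- the conjugate of `inclX k`, `k ∈ Π^tp_Y`, lies in `inclX(Π^tp_Y)`
  have hkY : g * M.inclX k * g⁻¹ ∈ M.GtpY.map M.inclX :=
    (e.map_inclX_GtpY_normal h).conj_mem _ (Subgroup.mem_map_of_mem _ hk) g
  obtain ⟨k', hk', hk'eq⟩ := hkY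
  refine ⟨e.conjX g y ^ n * k', (M.mem_comap_toZ_zpowers_iff n _).2 ⟨e.conjX g y, k', hk', rfl⟩, ?_⟩
  rw [map_mul, map_zpow, e.inclX_conjX, hk'eq, map_mul, map_zpow, conj_zpow]
  group

end CLevelData

end MuTwoSetting

end Literature.AnabelianGeometry.EtaleTheta

end
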